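import Literature.Combinatorics.SimpleGraph.CliqueComplexLaplacian
import Literature.LinearAlgebra.FiniteDimensionalHodgeTheory
import HarnessLib

/-!
# Betti numbers of a clique complex are the nullities of its combinatorial Laplacians
# (Eckmann's discrete Hodge theorem, as used by quantum Betti-number estimation)

HONEST FRAMING: instance-level adjudication of specific advantage claims; no claim about
BQP vs BPP or the summit.

`Literature/Combinatorics/SimpleGraph/CliqueComplexLaplacian.lean` records, for a finite simple
graph `G` on a linearly ordered vertex type, the integer simplicial boundary matrices `boundary G k`
(`∂_k`, rows = `k`-vertex cliques, columns = `(k+1)`-vertex cliques, i.e. `∂_k : C_k → C_{k-1}` with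
`C_k` the chains on the `k`-simplices = `(k+1)`-vertex cliques, *augmented*: `C_{-1}` is spanned
by the empty clique) and the combinatorial Laplace operators
`laplacian G k = ∂_{k+1} ∂_{k+1}ᵀ + ∂_kᵀ ∂_k` on `k`-simplices
[cite: HorakJost2013, Definition 2.1], and proves `∂_k ∂_{k+1} = 0` (`boundary_mul_boundary`);
it deliberately says nothing about Betti numbers.  This file supplies that link — the statement
every quantum algorithm for topological data analysis starts from:

> "Hodge theory implies that the `k`'th homology group `H_k = Ker ∂_k / Im ∂_{k+1} ≅ Ker Δ_k`.
> As above, the dimension of this kernel is the `k`'th Betti number."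
> [cite: LloydGarneroneZanardi2014, §3 (with `Δ_k = ∂_k† ∂_k + ∂_{k+1} ∂_{k+1}†)]

> "`β_k = dim Ker ∂_k - dim Im ∂_{k+1} = dim Ker ∂_k + dim Ker ∂_{k+1} - dim 𝓗_{k+1}` (7)"
> [cite: LloydGarneroneZanardi2014, eq. (7)]

> "Theorem 2.2 (Eckmann 1944). For an abstract simplicial complex `K`, `ker 𝓛_i(K) ≅ H̃^i(K, ℝ)`."
> with the proof `ker 𝓛_i(K) = ker δ_i^* δ_i ∩ ker δ_{i-1} δ_{i-1}^* = ker δ_i ∩ ker δ_{i-1}^*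
>  = ker δ_i ∩ (im δ_{i-1})^⊥ ≅ H̃^i(K, ℝ)` [cite: HorakJost2013, Theorem 2.2 and its proof]

(Horak–Jost work with the coboundaries `δ_i = ∂_{i+1}^*` of the augmented cochain complex, so their
`H̃` is *reduced* (co)homology; over a field the homological and cohomological dimensions agree, and
`𝓛_i = L_i` is the operator `laplacian G i` of the companion file when all weights are `1`.)

## Contents (all proved; coefficients in any linearly ordered field `𝕜`, e.g. `ℚ` or `ℝ`)

§1 — the dot-product instance of the tree's finite-dimensional Hodge theory
(`Literature.LinearAlgebra.FiniteHodge`, which is stated for abstract adjoint pairs and anisotropic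
bilinear forms): for matrices `A : l × m`, `B : m × n` over `𝕜` with `A * B = 0`,
* `ker_mulVecLin_transpose_mul_self_add` — `ker (B Bᵀ + Aᵀ A) = ker A ⊓ ker Bᵀ`;
* `finrank_ker_inf_ker_transpose_add_rank` — `dim (ker A ⊓ ker Bᵀ) + rank B = dim ker A`;
* `finrank_ker_transpose_mul_self_add_eq` — `dim ker (B Bᵀ + Aᵀ A) = dim (ker A ⧸ im B)`.

§2 — the clique complex of `G` with coefficients in `𝕜`: `boundaryIn 𝕜 G k` (`∂_k`),
`laplacianIn 𝕜 G k` (`L_k`), the (reduced) Betti number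
`betti 𝕜 G k = dim_𝕜 (ker ∂_k ⧸ im ∂_{k+1})`, and
* `boundaryIn_mul_boundaryIn` (`∂_k ∂_{k+1} = 0`), `laplacianIn_eq`
  (`L_k = ∂_{k+1}∂_{k+1}ᵀ + ∂_kᵀ∂_k`), `range_boundaryIn_le_ker` (`im ∂_{k+1} ≤ ker ∂_k`);
* **`ker_laplacianIn_eq`** — `ker L_k = ker ∂_k ⊓ ker ∂_{k+1}ᵀ` and its pointwise form
  `laplacianIn_mulVec_eq_zero_iff` [cite: HorakJost2013, Theorem 2.2 (proof)];
* **`finrank_ker_laplacianIn_eq_betti`** — `dim ker L_k = β̃_k` [cite: HorakJost2013, Theorem 2.2]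
  [cite: LloydGarneroneZanardi2014, §3];
* **`betti_add_rank_add_rank`** — `β̃_k + rank ∂_k + rank ∂_{k+1} = N_{k+1}` (`N_j` = number of
  `j`-vertex cliques), and the signed forms `betti_eq_finrank_ker_sub_rank`
  (`β̃_k = dim ker ∂_k - rank ∂_{k+1}`), `betti_eq_card_sub_rank_sub_rank`
  [cite: LloydGarneroneZanardi2014, eq. (7)] — the identity that classical rank computations use;
* `finrank_ker_laplacianIn_add_rank_laplacianIn` — `dim ker L_k + rank L_k = N_{k+1}` (so the
  multiplicity of the eigenvalue `0` of `L_k`, which is what the phase-estimation step reads off, is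
  `β̃_k`: `card_sub_rank_laplacianIn_eq_betti`).

What is NOT here: the identification of `betti 𝕜 G 0 + 1` with the number of connected components of
a nonempty `G` (reduced versus unreduced `β_0`); persistence (the `ε`-filtration of
[cite: LloydGarneroneZanardi2014, §2]); independence of `β̃_k` from the ordered field `𝕜`; any
complexity statement, quantum or classical.  No named facts, no `sorry`.
-/

namespace Literature.Combinatorics.SimpleGraph

open Finset Matrix Literature.LinearAlgebra

namespace CliqueComplex

/-! ## §1 Dot-product Hodge theory for a pair of matrices with `A * B = 0` -/

section MatrixHodge

variable (𝕜 : Type*) [Field 𝕜]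
variable {l m n : Type*} [Fintype m] [Fintype n]

/-- The dot product on `ι → 𝕜` as a bilinear form — the inner product on cochains with all weights
equal to `1` ("After choosing inner products `( , )_{C^i}` …"; Definition 2.1 with `w ≡ 1`).
[cite: HorakJost2013, §2 and Definition 2.1] -/
def dotForm (ι : Type*) [Fintype ι] : LinearMap.BilinForm 𝕜 (ι → 𝕜) :=
  LinearMap.mk₂ 𝕜 (fun v w => v ⬝ᵥ w) (fun _ _ _ => add_dotProduct _ _ _)
    (fun _ _ _ => smul_dotProduct _ _ _) (fun _ _ _ => dotProduct_add _ _ _)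
    (fun _ _ _ => dotProduct_smul _ _ _)

variable {𝕜}

/-- `dotForm 𝕜 ι v w = v ⬝ᵥ w`. [cite: HorakJost2013, §2] -/
@[simp] theorem dotForm_apply {ι : Type*} [Fintype ι] (v w : ι → 𝕜) : dotForm 𝕜 ι v w = v ⬝ᵥ w :=
  rfl

/-- The dot product is a reflexive bilinear form. [folklore] -/
private theorem dotForm_isRefl (ι : Type*) [Fintype ι] : (dotForm 𝕜 ι).IsRefl := by
  intro v w h
  rw [dotForm_apply] at h ⊢
  rwa [dotProduct_comm]

/-- Over a linearly ordered field the dot product is anisotropic: `v ⬝ᵥ v = 0 → v = 0`.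
[folklore] -/
private theorem dotForm_anisotropic [LinearOrder 𝕜] [IsStrictOrderedRing 𝕜] (ι : Type*) [Fintype ι]
    (v : ι → 𝕜) (h : dotForm 𝕜 ι v v = 0) : v = 0 :=
  dotProduct_self_eq_zero.1 h

/-- `M` and `Mᵀ` are adjoint for the dot products: `(M u) ⬝ v = u ⬝ (Mᵀ v)`
("`δ_i` can be viewed as the dual of the boundary map `∂_{i+1}`"). [cite: HorakJost2013, §2] -/
theorem dotForm_mulVecLin (M : Matrix m n 𝕜) (u : n → 𝕜) (v : m → 𝕜) :
    dotForm 𝕜 m (M.mulVecLin u) v = dotForm 𝕜 n u (Mᵀ.mulVecLin v) := by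
  simp only [dotForm_apply, Matrix.mulVecLin_apply]
  rw [dotProduct_comm, dotProduct_mulVec, ← mulVec_transpose, dotProduct_comm]

/-- `A * B = 0` as the chain-complex identity `A (B u) = 0`. [folklore] -/
private theorem mulVecLin_mulVecLin_eq_zero {A : Matrix l m 𝕜} {B : Matrix m n 𝕜} (hAB : A * B = 0)
    (u : n → 𝕜) : A.mulVecLin (B.mulVecLin u) = 0 := by
  simp only [Matrix.mulVecLin_apply, mulVec_mulVec, hAB, zero_mulVec]

/-- `A * B = 0` gives `im B ≤ ker A`. [folklore] -/
private theorem range_mulVecLin_le_ker {A : Matrix l m 𝕜} {B : Matrix m n 𝕜} (hAB : A * B = 0) :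
    LinearMap.range B.mulVecLin ≤ LinearMap.ker A.mulVecLin := by
  rintro _ ⟨u, rfl⟩
  exact mulVecLin_mulVecLin_eq_zero hAB u

/-- The abstract Laplacian `d₀ δ₁ + δ₂ d₁` of `FiniteHodge`, instantiated with `d₀ = B`, `d₁ = A`,
`δ₁ = Bᵀ`, `δ₂ = Aᵀ`, is the matrix `B Bᵀ + Aᵀ A`. [cite: HorakJost2013, Definition 2.1 (iii)] -/
theorem finiteHodge_laplacian_eq [Fintype l] (A : Matrix l m 𝕜) (B : Matrix m n 𝕜) :
    FiniteHodge.laplacian B.mulVecLin A.mulVecLin Bᵀ.mulVecLin Aᵀ.mulVecLin =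
      (B * Bᵀ + Aᵀ * A).mulVecLin := by
  rw [Matrix.mulVecLin_add, Matrix.mulVecLin_mul, Matrix.mulVecLin_mul]
  rfl

/-- **`ker (B Bᵀ + Aᵀ A) = ker A ∩ ker Bᵀ`** when `A B = 0` — the first two lines of the proof of
Eckmann's theorem, `ker 𝓛_i = ker δ_i^*δ_i ∩ ker δ_{i-1}δ_{i-1}^* = ker δ_i ∩ ker δ_{i-1}^*`.
[cite: HorakJost2013, Theorem 2.2 (proof)] -/
theorem ker_mulVecLin_transpose_mul_self_add [LinearOrder 𝕜] [IsStrictOrderedRing 𝕜]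
    [Fintype l] (A : Matrix l m 𝕜) (B : Matrix m n 𝕜) (hAB : A * B = 0) :
    LinearMap.ker (B * Bᵀ + Aᵀ * A).mulVecLin =
      LinearMap.ker A.mulVecLin ⊓ LinearMap.ker Bᵀ.mulVecLin := by
  rw [← finiteHodge_laplacian_eq]
  exact FiniteHodge.ker_laplacian_eq_harmonic B.mulVecLin A.mulVecLin Bᵀ.mulVecLin Aᵀ.mulVecLin
    (dotForm 𝕜 n) (dotForm 𝕜 m) (dotForm 𝕜 l) (mulVecLin_mulVecLin_eq_zero hAB)
    (fun u v => dotForm_mulVecLin B u v) (fun v w => dotForm_mulVecLin A v w)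
    (dotForm_anisotropic n) (dotForm_anisotropic m) (dotForm_anisotropic l)

/-- Pointwise form: `(B Bᵀ + Aᵀ A) x = 0 ↔ A x = 0 ∧ Bᵀ x = 0`.
[cite: HorakJost2013, Theorem 2.2 (proof)] -/
theorem transpose_mul_self_add_mulVec_eq_zero_iff [LinearOrder 𝕜] [IsStrictOrderedRing 𝕜]
    [Fintype l] (A : Matrix l m 𝕜) (B : Matrix m n 𝕜) (hAB : A * B = 0) (x : m → 𝕜) :
    (B * Bᵀ + Aᵀ * A) *ᵥ x = 0 ↔ A *ᵥ x = 0 ∧ Bᵀ *ᵥ x = 0 := by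
  have h := Submodule.ext_iff.1 (ker_mulVecLin_transpose_mul_self_add A B hAB) x
  simpa only [Submodule.mem_inf, LinearMap.mem_ker, Matrix.mulVecLin_apply] using h

/-- **`dim (ker A ∩ ker Bᵀ) + rank B = dim ker A`**: inside the cycles, the harmonic space is a
complement of the boundaries (`ker δ_i = im δ_{i-1} ⊕ (ker δ_i ∩ (im δ_{i-1})^⊥)`, the third line of
the proof of Theorem 2.2, together with the count `dim ker δ_i = dim H̃^i + dim im δ_{i-1}`).
[cite: HorakJost2013, Theorem 2.2 (proof) and §3 (dimension count)] -/
theorem finrank_ker_inf_ker_transpose_add_rank [LinearOrder 𝕜] [IsStrictOrderedRing 𝕜]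
    (A : Matrix l m 𝕜) (B : Matrix m n 𝕜) (hAB : A * B = 0) :
    Module.finrank 𝕜 ↥(LinearMap.ker A.mulVecLin ⊓ LinearMap.ker Bᵀ.mulVecLin) + B.rank =
      Module.finrank 𝕜 ↥(LinearMap.ker A.mulVecLin) := by
  have hsup := FiniteHodge.range_sup_harmonic_eq_ker B.mulVecLin A.mulVecLin Bᵀ.mulVecLin
    (dotForm 𝕜 n) (dotForm 𝕜 m) (dotForm_isRefl m) (dotForm_anisotropic m)
    (mulVecLin_mulVecLin_eq_zero hAB) (fun u v => dotForm_mulVecLin B u v) (dotForm_anisotropic n)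
  have hdisj := FiniteHodge.disjoint_range_harmonic B.mulVecLin A.mulVecLin Bᵀ.mulVecLin
    (dotForm 𝕜 n) (dotForm 𝕜 m) (fun u v => dotForm_mulVecLin B u v) (dotForm_anisotropic m)
  have key := Submodule.finrank_sup_add_finrank_inf_eq (LinearMap.range B.mulVecLin)
    (FiniteHodge.harmonic A.mulVecLin Bᵀ.mulVecLin)
  rw [hsup, hdisj.eq_bot, finrank_bot, add_zero] at key
  rw [Matrix.rank, key, add_comm]
  rfl

/-- **`dim ker (B Bᵀ + Aᵀ A) = dim (ker A ⧸ im B)`** — Eckmann's theorem `ker 𝓛 ≅ H̃` for the pair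
`(A, B)`, via the harmonic representatives of `FiniteHodge.harmonicEquiv`.
[cite: HorakJost2013, Theorem 2.2] -/
theorem finrank_ker_transpose_mul_self_add_eq [LinearOrder 𝕜] [IsStrictOrderedRing 𝕜]
    [Fintype l] (A : Matrix l m 𝕜) (B : Matrix m n 𝕜) (hAB : A * B = 0) :
    Module.finrank 𝕜 ↥(LinearMap.ker (B * Bᵀ + Aᵀ * A).mulVecLin) =
      Module.finrank 𝕜 (↥(LinearMap.ker A.mulVecLin) ⧸
        (LinearMap.range B.mulVecLin).comap (LinearMap.ker A.mulVecLin).subtype) := by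
  rw [ker_mulVecLin_transpose_mul_self_add A B hAB]
  exact (FiniteHodge.harmonicEquiv B.mulVecLin A.mulVecLin Bᵀ.mulVecLin (dotForm 𝕜 n) (dotForm 𝕜 m)
    (dotForm_isRefl m) (dotForm_anisotropic m) (mulVecLin_mulVecLin_eq_zero hAB)
    (fun u v => dotForm_mulVecLin B u v) (dotForm_anisotropic n)).finrank_eq

/-- The homology dimension as a difference: `dim (ker A ⧸ im B) + rank B = dim ker A`.
[cite: HorakJost2013, §3 (`dim ker δ_i = dim H̃^i + dim im δ_{i-1}`)] -/
theorem finrank_quotient_add_rank (A : Matrix l m 𝕜) (B : Matrix m n 𝕜) (hAB : A * B = 0) :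
    Module.finrank 𝕜 (↥(LinearMap.ker A.mulVecLin) ⧸
        (LinearMap.range B.mulVecLin).comap (LinearMap.ker A.mulVecLin).subtype) + B.rank =
      Module.finrank 𝕜 ↥(LinearMap.ker A.mulVecLin) := by
  rw [Matrix.rank, ← (Submodule.comapSubtypeEquivOfLe (range_mulVecLin_le_ker hAB)).finrank_eq]
  exact Submodule.finrank_quotient_add_finrank _

/-- Rank–nullity for `A : l × m`: `dim ker A + rank A = |m|` (`dim C^i = dim ker δ_i + dim im δ_i`).
[cite: HorakJost2013, §3] -/
theorem finrank_ker_add_rank (A : Matrix l m 𝕜) :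
    Module.finrank 𝕜 ↥(LinearMap.ker A.mulVecLin) + A.rank = Fintype.card m := by
  rw [Matrix.rank, add_comm, LinearMap.finrank_range_add_finrank_ker,
    Module.finrank_fintype_fun_eq_card]

end MatrixHodge

/-! ## §2 The clique complex with coefficients in an ordered field -/

section Clique

variable (𝕜 : Type*) [Field 𝕜]
variable {V : Type*} [Fintype V] [LinearOrder V] (G : _root_.SimpleGraph V) [DecidableRel G.Adj]

/-- The simplicial boundary matrix `∂_k` of the clique complex of `G` with coefficients in `𝕜`
(rows: `k`-vertex cliques, columns: `(k+1)`-vertex cliques): the integer matrix `boundary G k` cast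
to `𝕜`. [cite: HorakJost2013, §2] -/
def boundaryIn (k : ℕ) : Matrix (G.cliqueFinset k) (G.cliqueFinset (k + 1)) 𝕜 :=
  (boundary G k).map (Int.cast : ℤ → 𝕜)

/-- The combinatorial Laplacian `L_k` of the clique complex of `G` on `k`-simplices
(`(k+1)`-vertex cliques) with coefficients in `𝕜`: the integer matrix `laplacian G k` cast to `𝕜`.
[cite: HorakJost2013, Definition 2.1 (iii), `w ≡ 1`] -/
def laplacianIn (k : ℕ) : Matrix (G.cliqueFinset (k + 1)) (G.cliqueFinset (k + 1)) 𝕜 :=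
  (laplacian G k).map (Int.cast : ℤ → 𝕜)

/-- The `k`-th (reduced) Betti number of the clique complex of `G` over `𝕜`:
`β̃_k = dim_𝕜 H̃_k = dim_𝕜 (ker ∂_k ⧸ im ∂_{k+1})`, the `k`-cycles modulo the `k`-boundaries
("The `k`th Betti number `β_k` is equal to the dimension of `H_k`, which in turn is equal to the
dimension of the kernel of `∂_k` minus the dimension of the image of `∂_{k+1}`").  Because
`boundary G 0` is the augmentation onto the empty clique, this is the reduced Betti number
(`= β_k` for `k ≥ 1`). [cite: LloydGarneroneZanardi2014, §2 (before eq. (7))]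
[cite: HorakJost2013, §2 (`H̃^i := ker δ_i / im δ_{i-1}`)] -/
noncomputable def betti (k : ℕ) : ℕ :=
  Module.finrank 𝕜 (↥(LinearMap.ker (boundaryIn 𝕜 G k).mulVecLin) ⧸
    (LinearMap.range (boundaryIn 𝕜 G (k + 1)).mulVecLin).comap
      (LinearMap.ker (boundaryIn 𝕜 G k).mulVecLin).subtype)

/-- Entries of `boundaryIn`: the integer incidence signs of `boundary G k`, cast to `𝕜`.
[cite: HorakJost2013, §2] -/
@[simp] theorem boundaryIn_apply (k : ℕ) (σ : G.cliqueFinset k) (τ : G.cliqueFinset (k + 1)) :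
    boundaryIn 𝕜 G k σ τ = ((boundary G k σ τ : ℤ) : 𝕜) := rfl

/-- Entries of `laplacianIn`: the entries of `laplacian G k`, cast to `𝕜`.
[cite: HorakJost2013, Definition 2.1 (iii)] -/
@[simp] theorem laplacianIn_apply (k : ℕ) (σ τ : G.cliqueFinset (k + 1)) :
    laplacianIn 𝕜 G k σ τ = ((laplacian G k σ τ : ℤ) : 𝕜) := rfl

/-- **`∂_k ∂_{k+1} = 0`** over `𝕜`. [cite: HorakJost2013, §2] -/
theorem boundaryIn_mul_boundaryIn (k : ℕ) : boundaryIn 𝕜 G k * boundaryIn 𝕜 G (k + 1) = 0 := by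
  have h := (Matrix.map_mul (L := boundary G k) (M := boundary G (k + 1))
    (f := Int.castRingHom 𝕜)).symm
  rw [boundary_mul_boundary, Int.coe_castRingHom] at h
  rw [boundaryIn, boundaryIn, h]
  exact Matrix.map_zero _ Int.cast_zero

/-- **`L_k = ∂_{k+1} ∂_{k+1}ᵀ + ∂_kᵀ ∂_k`** over `𝕜`. [cite: HorakJost2013, Definition 2.1] -/
theorem laplacianIn_eq (k : ℕ) :
    laplacianIn 𝕜 G k = boundaryIn 𝕜 G (k + 1) * (boundaryIn 𝕜 G (k + 1))ᵀ +
      (boundaryIn 𝕜 G k)ᵀ * boundaryIn 𝕜 G k := by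
  have h1 := Matrix.map_mul (L := boundary G (k + 1)) (M := (boundary G (k + 1))ᵀ)
    (f := Int.castRingHom 𝕜)
  have h2 := Matrix.map_mul (L := (boundary G k)ᵀ) (M := boundary G k) (f := Int.castRingHom 𝕜)
  rw [Int.coe_castRingHom] at h1 h2
  rw [laplacianIn, laplacian, upLaplacian, downLaplacian, Matrix.map_add _ Int.cast_add, h1, h2,
    Matrix.transpose_map, Matrix.transpose_map]
  rfl

/-- `im ∂_{k+1} ≤ ker ∂_k` (boundaries are cycles). [cite: HorakJost2013, §2] -/
theorem range_boundaryIn_le_ker (k : ℕ) :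
    LinearMap.range (boundaryIn 𝕜 G (k + 1)).mulVecLin ≤
      LinearMap.ker (boundaryIn 𝕜 G k).mulVecLin :=
  range_mulVecLin_le_ker (boundaryIn_mul_boundaryIn 𝕜 G k)

/-- **`ker L_k = ker ∂_k ∩ ker ∂_{k+1}ᵀ`** (harmonic chains are the cycles that are also cocycles).
[cite: HorakJost2013, Theorem 2.2 (proof)] -/
theorem ker_laplacianIn_eq [LinearOrder 𝕜] [IsStrictOrderedRing 𝕜] (k : ℕ) :
    LinearMap.ker (laplacianIn 𝕜 G k).mulVecLin =
      LinearMap.ker (boundaryIn 𝕜 G k).mulVecLin ⊓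
        LinearMap.ker (boundaryIn 𝕜 G (k + 1))ᵀ.mulVecLin := by
  rw [laplacianIn_eq]
  exact ker_mulVecLin_transpose_mul_self_add _ _ (boundaryIn_mul_boundaryIn 𝕜 G k)

/-- Pointwise: `L_k x = 0 ↔ ∂_k x = 0 ∧ ∂_{k+1}ᵀ x = 0`.
[cite: HorakJost2013, Theorem 2.2 (proof)] -/
theorem laplacianIn_mulVec_eq_zero_iff [LinearOrder 𝕜] [IsStrictOrderedRing 𝕜] (k : ℕ)
    (x : G.cliqueFinset (k + 1) → 𝕜) :
    laplacianIn 𝕜 G k *ᵥ x = 0 ↔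
      boundaryIn 𝕜 G k *ᵥ x = 0 ∧ (boundaryIn 𝕜 G (k + 1))ᵀ *ᵥ x = 0 := by
  rw [laplacianIn_eq]
  exact transpose_mul_self_add_mulVec_eq_zero_iff _ _ (boundaryIn_mul_boundaryIn 𝕜 G k) x

/-- **Eckmann's discrete Hodge theorem for the clique complex: `dim ker L_k = β̃_k`**
("`ker 𝓛_i(K) ≅ H̃^i(K, ℝ)`"; "`H_k = Ker ∂_k / Im ∂_{k+1} ≅ Ker Δ_k` … the dimension of this kernel
is the `k`'th Betti number"). [cite: HorakJost2013, Theorem 2.2]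
[cite: LloydGarneroneZanardi2014, §3] -/
theorem finrank_ker_laplacianIn_eq_betti [LinearOrder 𝕜] [IsStrictOrderedRing 𝕜] (k : ℕ) :
    Module.finrank 𝕜 ↥(LinearMap.ker (laplacianIn 𝕜 G k).mulVecLin) = betti 𝕜 G k := by
  rw [betti, laplacianIn_eq]
  exact finrank_ker_transpose_mul_self_add_eq _ _ (boundaryIn_mul_boundaryIn 𝕜 G k)

/-- `dim ker L_k + rank ∂_{k+1} = dim ker ∂_k`. [cite: HorakJost2013, Theorem 2.2 (proof) and §3] -/
theorem finrank_ker_laplacianIn_add_rank [LinearOrder 𝕜] [IsStrictOrderedRing 𝕜] (k : ℕ) :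
    Module.finrank 𝕜 ↥(LinearMap.ker (laplacianIn 𝕜 G k).mulVecLin) +
        (boundaryIn 𝕜 G (k + 1)).rank =
      Module.finrank 𝕜 ↥(LinearMap.ker (boundaryIn 𝕜 G k).mulVecLin) := by
  rw [ker_laplacianIn_eq]
  exact finrank_ker_inf_ker_transpose_add_rank _ _ (boundaryIn_mul_boundaryIn 𝕜 G k)

/-- `β̃_k + rank ∂_{k+1} = dim ker ∂_k` ("`β_k = dim Ker ∂_k - dim Im ∂_{k+1}`", additive form).
[cite: LloydGarneroneZanardi2014, eq. (7)] -/
theorem betti_add_rank (k : ℕ) :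
    betti 𝕜 G k + (boundaryIn 𝕜 G (k + 1)).rank =
      Module.finrank 𝕜 ↥(LinearMap.ker (boundaryIn 𝕜 G k).mulVecLin) :=
  finrank_quotient_add_rank _ _ (boundaryIn_mul_boundaryIn 𝕜 G k)

/-- **`β̃_k = dim ker ∂_k - rank ∂_{k+1}`**. [cite: LloydGarneroneZanardi2014, eq. (7)] -/
theorem betti_eq_finrank_ker_sub_rank (k : ℕ) :
    (betti 𝕜 G k : ℤ) =
      (Module.finrank 𝕜 ↥(LinearMap.ker (boundaryIn 𝕜 G k).mulVecLin) : ℤ) -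
        ((boundaryIn 𝕜 G (k + 1)).rank : ℤ) := by
  rw [← betti_add_rank 𝕜 G k]
  push_cast
  ring

/-- **`β̃_k + rank ∂_k + rank ∂_{k+1} = N_{k+1}`**, `N_{k+1} = #(k+1)`-vertex cliques `= dim C_k`
("`β_k = dim Ker ∂_k + dim Ker ∂_{k+1} - dim 𝓗_{k+1}`" combined with rank–nullity).
[cite: LloydGarneroneZanardi2014, eq. (7)] -/
theorem betti_add_rank_add_rank (k : ℕ) :
    betti 𝕜 G k + (boundaryIn 𝕜 G k).rank + (boundaryIn 𝕜 G (k + 1)).rank =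
      #(G.cliqueFinset (k + 1)) := by
  rw [add_right_comm, betti_add_rank, finrank_ker_add_rank, Fintype.card_coe]

/-- Signed form: `β̃_k = N_{k+1} - rank ∂_k - rank ∂_{k+1}` — the identity evaluated by classical
rank (Gaussian-elimination) computations of Betti numbers.
[cite: LloydGarneroneZanardi2014, eq. (7)] -/
theorem betti_eq_card_sub_rank_sub_rank (k : ℕ) :
    (betti 𝕜 G k : ℤ) = (#(G.cliqueFinset (k + 1)) : ℤ) - ((boundaryIn 𝕜 G k).rank : ℤ) -
      ((boundaryIn 𝕜 G (k + 1)).rank : ℤ) := by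
  rw [← betti_add_rank_add_rank 𝕜 G k]
  push_cast
  ring

/-- `dim ker L_k + rank L_k = N_{k+1}` (rank–nullity for the Laplacian on `C^k`,
`dim C^i = dim ker + dim im`). [cite: HorakJost2013, §3] -/
theorem finrank_ker_laplacianIn_add_rank_laplacianIn (k : ℕ) :
    Module.finrank 𝕜 ↥(LinearMap.ker (laplacianIn 𝕜 G k).mulVecLin) + (laplacianIn 𝕜 G k).rank =
      #(G.cliqueFinset (k + 1)) := by
  rw [finrank_ker_add_rank, Fintype.card_coe]

/-- Hence **the nullity `N_{k+1} - rank L_k` of the Laplacian — the multiplicity of its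
eigenvalue `0`, the quantity a phase-estimation run on `L_k` estimates — is `β̃_k`**.
[cite: LloydGarneroneZanardi2014, §3] [cite: HorakJost2013, §3 ("The number of zeros in the
spectrum … is equal to the dimension of its kernel")] -/
theorem card_sub_rank_laplacianIn_eq_betti [LinearOrder 𝕜] [IsStrictOrderedRing 𝕜] (k : ℕ) :
    (#(G.cliqueFinset (k + 1)) : ℤ) - ((laplacianIn 𝕜 G k).rank : ℤ) = betti 𝕜 G k := by
  rw [← finrank_ker_laplacianIn_add_rank_laplacianIn 𝕜 G k, ← finrank_ker_laplacianIn_eq_betti]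
  push_cast
  ring

end Clique

end CliqueComplex

end Literature.Combinatorics.SimpleGraph
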